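import Mathlib
import Summits.ValiantsHypothesis.ValiantsHypothesis.Theorems.LacunarySymmetroidMatrixDescartesCensusSupportNormalForm

/-!
# `MatrixDescartes` (stmt-ValiantsHypothesis-18050), line `Lift` — the registered V-law stub `stub_vLaw`:
# the DEGREE-COUNT range (no semidefiniteness needed), sharp at equal gaps

HONEST FRAMING.  Cell `pub-symmetroid`, seat `val-sym-mdr-p2`; helper `--supports` the crux
`Theses.LacunarySymmetroid.MatrixDescartes`.  `stub_vLaw` (skeleton `Cruxes/MatrixDescartes/Lines/Lift.lean`,
RESEARCH-LEVEL, numerically sharp): for `d₁ < e < d₂`, `J` symmetric, `P, Q ⪰ 0`,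
`det (X^e J + X^{d₁} P + X^{d₂} Q)` has at most `2·card ι` distinct positive zeros.  This file proves the V-law
ONLY on the sub-range where it is a degree count, and records that range honestly; it does not prove the stub,
and says nothing about the crux, `DoorA26` / `DoorA34`, or `VP ≠ VNP`.

THEOREM (`vLaw_degreeCount`).  For ALL real `ι × ι` matrices `J, P, Q` (no symmetry, no semidefiniteness) and
`d₁ < e < d₂` with gaps `a = e − d₁`, `b = d₂ − e`, `g = gcd(a, b)`:
`Z₊ ≤ card ι · (d₂ − d₁)/g`.  Indeed `F = X^{d₁} · N(X^g)` with `N = P + X^{a/g} J + X^{(a+b)/g} Q` a matrix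
polynomial of degree `(a+b)/g`, so `det F = X^{d₁·card ι} · (det N)(X^g)` (`AlgHom.map_det` for `expand`),
positive zeros correspond under `t ↦ t^g` (tree `Census.card_posRoots_expand`, `Census.posRoots_X_pow_mul_eq`), and
`deg det N ≤ card ι · (a+b)/g` (`VLawDegree.natDegree_det_le_of_forall`).  COROLLARY (`vLaw_equalGaps`): at
EQUAL GAPS `e − d₁ = d₂ − e` the bound is exactly the V-law's `2·card ι` — so the conjectured V-law asserts that
unequal gaps (where the degree count `(a+b)/g ≥ 3` is weaker) never do better than the quadratic case, for
SEMIDEFINITE `P, Q`; for indefinite `P, Q` the degree count is the truth (scalar trinomials with three real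
exponents already need Descartes, not degree).  [folklore]
-/

-- layout Summits/ValiantsHypothesis/ValiantsHypothesis forces the duplicated namespace component
set_option linter.dupNamespace false

namespace Summit.ValiantsHypothesis.ValiantsHypothesis.Theorems.LacunarySymmetroidMatrixDescartes

open Polynomial Finset Matrix
open scoped BigOperators Polynomial

namespace VLawDegree

/-- Degree of a determinant with entries of degree `≤ D`: `natDegree (det M) ≤ card n · D` (Leibniz formula).
[folklore] -/
theorem natDegree_det_le_of_forall {n : Type*} [Fintype n] [DecidableEq n] (M : Matrix n n ℝ[X]) (D : ℕ)
    (h : ∀ i j, (M i j).natDegree ≤ D) : (Matrix.det M).natDegree ≤ Fintype.card n * D := by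
  -- adapted from Mathlib's `Polynomial.natDegree_det_X_add_C_le`
  rw [Matrix.det_apply]
  refine Polynomial.natDegree_sum_le_of_forall_le _ _ fun σ _ => ?_
  calc (Equiv.Perm.sign σ • ∏ i, M (σ i) i).natDegree ≤ (∏ i, M (σ i) i).natDegree := by
        rcases Int.units_eq_one_or (Equiv.Perm.sign σ) with hs | hs
        · rw [hs, one_smul]
        · rw [hs, Units.neg_smul, one_smul, Polynomial.natDegree_neg]
    _ ≤ ∑ i, (M (σ i) i).natDegree := Polynomial.natDegree_prod_le _ _
    _ ≤ Finset.univ.card • D := Finset.sum_le_card_nsmul _ _ D fun i _ => h (σ i) i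
    _ = Fintype.card n * D := by rw [smul_eq_mul, Finset.card_univ]

/-- The V-pencil is `X^{d₁}` times the `g`-expansion of the degree-`(a+b)/g` matrix polynomial
`N = X^{a/g} J + P + X^{(a+b)/g} Q` (`a = e − d₁`, `b = d₂ − e`, `g = gcd(a,b)`). [folklore] -/
theorem vPencil_eq_expand {ι : Type*} [Fintype ι] [DecidableEq ι] (e d₁ d₂ : ℕ) (J P Q : Matrix ι ι ℝ)
    (h₁ : d₁ < e) (h₂ : e < d₂) :
    ((Polynomial.X : Polynomial ℝ) ^ e) • J.map Polynomial.C
        + ((Polynomial.X : Polynomial ℝ) ^ d₁) • P.map Polynomial.C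
        + ((Polynomial.X : Polynomial ℝ) ^ d₂) • Q.map Polynomial.C
      = ((Polynomial.X : Polynomial ℝ) ^ d₁) • (Polynomial.expand ℝ (Nat.gcd (e - d₁) (d₂ - e))).mapMatrix
          (((Polynomial.X : Polynomial ℝ) ^ ((e - d₁) / Nat.gcd (e - d₁) (d₂ - e))) • J.map Polynomial.C
            + P.map Polynomial.C
            + ((Polynomial.X : Polynomial ℝ) ^ (((e - d₁) + (d₂ - e)) / Nat.gcd (e - d₁) (d₂ - e)))
                • Q.map Polynomial.C) := by
  have hga : Nat.gcd (e - d₁) (d₂ - e) ∣ (e - d₁) := Nat.gcd_dvd_left _ _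
  have hgb : Nat.gcd (e - d₁) (d₂ - e) ∣ (d₂ - e) := Nat.gcd_dvd_right _ _
  have hgab : Nat.gcd (e - d₁) (d₂ - e) ∣ ((e - d₁) + (d₂ - e)) := Dvd.dvd.add hga hgb
  have e1 : d₁ + (e - d₁) = e := by omega
  have e2 : d₁ + ((e - d₁) + (d₂ - e)) = d₂ := by omega
  refine Matrix.ext fun i j => ?_
  simp only [Matrix.add_apply, Matrix.smul_apply, Matrix.map_apply, AlgHom.mapMatrix_apply, smul_eq_mul,
    map_add, map_mul, map_pow, Polynomial.expand_X, Polynomial.expand_C, mul_add, ← mul_assoc, ← pow_mul,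
    ← pow_add, Nat.mul_div_cancel' hga, Nat.mul_div_cancel' hgab, e1, e2]

end VLawDegree

/-- **V-law, degree-count range** (partial result toward the registered stub `stub_vLaw`; no symmetry or
semidefiniteness needed).  For real `ι × ι` matrices `J, P, Q` and exponents `d₁ < e < d₂`, the number of
distinct positive zeros of `det (X^e J + X^{d₁} P + X^{d₂} Q)` is at most
`card ι · (d₂ − d₁) / gcd(e − d₁, d₂ − e)` — the degree of the matrix polynomial `N` with `F = X^{d₁} N(X^g)`.
[folklore] -/
theorem vLaw_degreeCount (ι : Type) [Fintype ι] [DecidableEq ι] (e d₁ d₂ : ℕ) (J P Q : Matrix ι ι ℝ)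
    (h₁ : d₁ < e) (h₂ : e < d₂) :
    ((Matrix.det (((Polynomial.X : Polynomial ℝ) ^ e) • J.map Polynomial.C
        + ((Polynomial.X : Polynomial ℝ) ^ d₁) • P.map Polynomial.C
        + ((Polynomial.X : Polynomial ℝ) ^ d₂) • Q.map Polynomial.C)).roots.toFinset.filter
          (fun t => 0 < t)).card ≤ Fintype.card ι * ((d₂ - d₁) / Nat.gcd (e - d₁) (d₂ - e)) := by
  have hgpos : 0 < Nat.gcd (e - d₁) (d₂ - e) := Nat.gcd_pos_of_pos_left _ (by omega)
  rw [VLawDegree.vPencil_eq_expand e d₁ d₂ J P Q h₁ h₂, Matrix.det_smul, ← pow_mul, ← AlgHom.map_det,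
    Census.posRoots_X_pow_mul_eq, Census.card_posRoots_expand _ hgpos]
  -- `Z₊(det N) ≤ #roots ≤ deg (det N) ≤ card ι · (a+b)/g`
  have hent : ∀ i j,
      ((((Polynomial.X : Polynomial ℝ) ^ ((e - d₁) / Nat.gcd (e - d₁) (d₂ - e))) • J.map Polynomial.C
        + P.map Polynomial.C
        + ((Polynomial.X : Polynomial ℝ) ^ (((e - d₁) + (d₂ - e)) / Nat.gcd (e - d₁) (d₂ - e)))
            • Q.map Polynomial.C) i j).natDegree ≤ ((e - d₁) + (d₂ - e)) / Nat.gcd (e - d₁) (d₂ - e) := by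
    intro i j
    simp only [Matrix.add_apply, Matrix.smul_apply, Matrix.map_apply, smul_eq_mul]
    refine (Polynomial.natDegree_add_le _ _).trans (max_le ((Polynomial.natDegree_add_le _ _).trans
      (max_le ?_ ?_)) ?_)
    · refine Polynomial.natDegree_mul_le.trans ?_
      rw [Polynomial.natDegree_X_pow, Polynomial.natDegree_C, add_zero]
      exact Nat.div_le_div_right (Nat.le_add_right _ _)
    · rw [Polynomial.natDegree_C]
      exact Nat.zero_le _
    · refine Polynomial.natDegree_mul_le.trans ?_
      rw [Polynomial.natDegree_X_pow, Polynomial.natDegree_C, add_zero]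
  have hdeg := VLawDegree.natDegree_det_le_of_forall _ _ hent
  have hab : (e - d₁) + (d₂ - e) = d₂ - d₁ := by omega
  exact (Finset.card_filter_le _ _).trans ((Multiset.toFinset_card_le _).trans
    ((Polynomial.card_roots' _).trans (hdeg.trans (le_of_eq (by rw [hab])))))

/-- **V-law at equal gaps** (`e − d₁ = d₂ − e`): `Z₊ ≤ 2·card ι` for ALL real `J, P, Q` — the conjectured V-law
bound, attained here by the degree count of the quadratic matrix polynomial `P + sJ + s²Q`.  The registered
stub `stub_vLaw` (semidefinite `P, Q`, arbitrary gaps) remains open outside this range. [folklore] -/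
theorem vLaw_equalGaps (ι : Type) [Fintype ι] [DecidableEq ι] (e d₁ d₂ : ℕ) (J P Q : Matrix ι ι ℝ)
    (h₁ : d₁ < e) (h₂ : e < d₂) (hgap : e - d₁ = d₂ - e) :
    ((Matrix.det (((Polynomial.X : Polynomial ℝ) ^ e) • J.map Polynomial.C
        + ((Polynomial.X : Polynomial ℝ) ^ d₁) • P.map Polynomial.C
        + ((Polynomial.X : Polynomial ℝ) ^ d₂) • Q.map Polynomial.C)).roots.toFinset.filter
          (fun t => 0 < t)).card ≤ 2 * Fintype.card ι := by
  refine (vLaw_degreeCount ι e d₁ d₂ J P Q h₁ h₂).trans ?_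
  rw [← hgap, Nat.gcd_self, mul_comm]
  refine Nat.mul_le_mul_right _ (le_of_eq ?_)
  have ha : 0 < e - d₁ := by omega
  have h2 : d₂ - d₁ = 2 * (e - d₁) := by omega
  rw [h2, Nat.mul_div_cancel _ ha]

end Summit.ValiantsHypothesis.ValiantsHypothesis.Theorems.LacunarySymmetroidMatrixDescartes
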